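import Literature.Computability.AlgebraicComplexity.DIP20MonomialCountStabilisation
import Literature.Computability.AlgebraicComplexity.DIP20PlethysmCountingFormulaProofs
import Literature.Computability.AlgebraicComplexity.DIP20PlethysmValues
import HarnessLib

/-!
# Dörfler–Ikenmeyer–Panova 2019, Lemma 3.13: the tail `(3,3)` = `(3,3,0)`

Topic `Literature/Computability/AlgebraicComplexity`; sibling proofs file (D-0014) of
`DIP20MultiplicityObstructions.lean` (named fact `DIP20_lem_3_13`, of which this is one of the ten
non-hook tails; the eight hook-like tails are `DIP20_lem_3_13_of_hookLike` in `DIP20HookLikeTails`).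
No new facts, no new definitions.

J. Dörfler, C. Ikenmeyer, G. Panova, SIAM J. Appl. Algebra Geom. 4 (2020) = arXiv:1901.04576, Lemma 3.13
(arXiv p. 7): "If `λ` is a 4-partition of `7d` and `λ̄ ∈ Y`, then `a_λ(d[7]) = 0`", "proven exactly like
Lemma 3.7" (a finite calculation); the tree's `DIP20_lem_3_13` states the vanishing for every inner
degree `n`. This file is the TEMPLATE of the finite calculation for 4 rows, on the tail `(3,3,0)`:
`plethysmCoeff_rowDual_tail330_eq_zero` (clamp `T = 6`, 22 reachable pairs). Route: degree pinning
(`plethysmCoeff_rowDual_eq_zero_of_not_dvd`), (4.4) over `𝔖₄` (`DIP20_eq_4_4_holds`, no symbolic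
expansion), the whole alternating sum clamped at `(min d 6, min n 6)` (`dip44_sum_cons_clamp`, from the
stabilisation bijections), and closed kernel evaluations `t330_d'_n'` (one declaration each, so
that the kernel's memory is per pair); the other pairs `(d',n')` are excluded by `|μ| = dn ≥ 9`.
The other nine non-hook tails go the same way with `T = |μ̄|` (kernel cost per pair grows with `T`; see
the typing cell's handoff for the table).

HONEST FRAMING: a finite plethysm computation of the toy model; nothing here bears on permanent versus
determinant; VP ≠ VNP is not proved.

## References

* J. Dörfler, C. Ikenmeyer, G. Panova, SIAM J. Appl. Algebra Geom. 4 (2020) = arXiv:1901.04576,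
  Lemma 3.13 and eqs. (4.3)–(4.4). [DorflerIkenmeyerPanova2020]

## Mathlib and tree

Tree: `DIP20_eq_4_4_holds` (`DIP20PlethysmCountingFormulaProofs`), `dip44_sum_cons_clamp`
(`DIP20MonomialCountStabilisation`), `plethysmCoeff_rowDual_eq_zero_of_not_dvd` (`DIP20PlethysmValues`),
`dipMonomialCount_eq_L` (`DIP20MonomialCounts`).

Provenance: val-lit cell, typer val-lit-t07 g2 (DAG row DIP2020-A); the lemma generator is
`scratch/gentail.py 3,3,0` of the typing session (verifies the sums in Python first).
-/

noncomputable section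

namespace Literature.Computability.AlgebraicComplexity

open _root_.Literature.NumberTheory.DiophantineGeometry

/-- Clamped (4.4)-sum for the tail `(3, 3, 0)` at `(d',n') = (1,6)` vanishes (kernel). [cite: DorflerIkenmeyerPanova2020, Lemma 3.13 (arXiv p. 7)] -/
private theorem t330_1_6 :
    (∑ π : Equiv.Perm (Fin (3 + 1)), ((Equiv.Perm.sign π : ℤˣ) : ℤ) *
      (if ∀ i : Fin (3 + 1), (i : ℕ) ≤ (Fin.cons (1 * 6 - 6) ![3, 3, 0] : Fin (3 + 1) → ℕ) i + (π i : ℕ)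
        then (dipMonomialCount (fun i : Fin (3 + 1) => (Fin.cons (1 * 6 - 6) ![3, 3, 0] : Fin (3 + 1) → ℕ) i + (π i : ℕ) - (i : ℕ)) 1 6 : ℤ)
        else 0)) = 0 := by
  simp only [dipMonomialCount_eq_L]
  decide +kernel

/-- Clamped (4.4)-sum for the tail `(3, 3, 0)` at `(d',n') = (2,5)` vanishes (kernel). [cite: DorflerIkenmeyerPanova2020, Lemma 3.13 (arXiv p. 7)] -/
private theorem t330_2_5 :
    (∑ π : Equiv.Perm (Fin (3 + 1)), ((Equiv.Perm.sign π : ℤˣ) : ℤ) *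
      (if ∀ i : Fin (3 + 1), (i : ℕ) ≤ (Fin.cons (2 * 5 - 6) ![3, 3, 0] : Fin (3 + 1) → ℕ) i + (π i : ℕ)
        then (dipMonomialCount (fun i : Fin (3 + 1) => (Fin.cons (2 * 5 - 6) ![3, 3, 0] : Fin (3 + 1) → ℕ) i + (π i : ℕ) - (i : ℕ)) 2 5 : ℤ)
        else 0)) = 0 := by
  simp only [dipMonomialCount_eq_L]
  decide +kernel

/-- Clamped (4.4)-sum for the tail `(3, 3, 0)` at `(d',n') = (2,6)` vanishes (kernel). [cite: DorflerIkenmeyerPanova2020, Lemma 3.13 (arXiv p. 7)] -/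
private theorem t330_2_6 :
    (∑ π : Equiv.Perm (Fin (3 + 1)), ((Equiv.Perm.sign π : ℤˣ) : ℤ) *
      (if ∀ i : Fin (3 + 1), (i : ℕ) ≤ (Fin.cons (2 * 6 - 6) ![3, 3, 0] : Fin (3 + 1) → ℕ) i + (π i : ℕ)
        then (dipMonomialCount (fun i : Fin (3 + 1) => (Fin.cons (2 * 6 - 6) ![3, 3, 0] : Fin (3 + 1) → ℕ) i + (π i : ℕ) - (i : ℕ)) 2 6 : ℤ)
        else 0)) = 0 := by
  simp only [dipMonomialCount_eq_L]
  decide +kernel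

/-- Clamped (4.4)-sum for the tail `(3, 3, 0)` at `(d',n') = (3,3)` vanishes (kernel). [cite: DorflerIkenmeyerPanova2020, Lemma 3.13 (arXiv p. 7)] -/
private theorem t330_3_3 :
    (∑ π : Equiv.Perm (Fin (3 + 1)), ((Equiv.Perm.sign π : ℤˣ) : ℤ) *
      (if ∀ i : Fin (3 + 1), (i : ℕ) ≤ (Fin.cons (3 * 3 - 6) ![3, 3, 0] : Fin (3 + 1) → ℕ) i + (π i : ℕ)
        then (dipMonomialCount (fun i : Fin (3 + 1) => (Fin.cons (3 * 3 - 6) ![3, 3, 0] : Fin (3 + 1) → ℕ) i + (π i : ℕ) - (i : ℕ)) 3 3 : ℤ)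
        else 0)) = 0 := by
  simp only [dipMonomialCount_eq_L]
  decide +kernel

/-- Clamped (4.4)-sum for the tail `(3, 3, 0)` at `(d',n') = (3,4)` vanishes (kernel). [cite: DorflerIkenmeyerPanova2020, Lemma 3.13 (arXiv p. 7)] -/
private theorem t330_3_4 :
    (∑ π : Equiv.Perm (Fin (3 + 1)), ((Equiv.Perm.sign π : ℤˣ) : ℤ) *
      (if ∀ i : Fin (3 + 1), (i : ℕ) ≤ (Fin.cons (3 * 4 - 6) ![3, 3, 0] : Fin (3 + 1) → ℕ) i + (π i : ℕ)
        then (dipMonomialCount (fun i : Fin (3 + 1) => (Fin.cons (3 * 4 - 6) ![3, 3, 0] : Fin (3 + 1) → ℕ) i + (π i : ℕ) - (i : ℕ)) 3 4 : ℤ)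
        else 0)) = 0 := by
  simp only [dipMonomialCount_eq_L]
  decide +kernel

/-- Clamped (4.4)-sum for the tail `(3, 3, 0)` at `(d',n') = (3,5)` vanishes (kernel). [cite: DorflerIkenmeyerPanova2020, Lemma 3.13 (arXiv p. 7)] -/
private theorem t330_3_5 :
    (∑ π : Equiv.Perm (Fin (3 + 1)), ((Equiv.Perm.sign π : ℤˣ) : ℤ) *
      (if ∀ i : Fin (3 + 1), (i : ℕ) ≤ (Fin.cons (3 * 5 - 6) ![3, 3, 0] : Fin (3 + 1) → ℕ) i + (π i : ℕ)
        then (dipMonomialCount (fun i : Fin (3 + 1) => (Fin.cons (3 * 5 - 6) ![3, 3, 0] : Fin (3 + 1) → ℕ) i + (π i : ℕ) - (i : ℕ)) 3 5 : ℤ)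
        else 0)) = 0 := by
  simp only [dipMonomialCount_eq_L]
  decide +kernel

/-- Clamped (4.4)-sum for the tail `(3, 3, 0)` at `(d',n') = (3,6)` vanishes (kernel). [cite: DorflerIkenmeyerPanova2020, Lemma 3.13 (arXiv p. 7)] -/
private theorem t330_3_6 :
    (∑ π : Equiv.Perm (Fin (3 + 1)), ((Equiv.Perm.sign π : ℤˣ) : ℤ) *
      (if ∀ i : Fin (3 + 1), (i : ℕ) ≤ (Fin.cons (3 * 6 - 6) ![3, 3, 0] : Fin (3 + 1) → ℕ) i + (π i : ℕ)
        then (dipMonomialCount (fun i : Fin (3 + 1) => (Fin.cons (3 * 6 - 6) ![3, 3, 0] : Fin (3 + 1) → ℕ) i + (π i : ℕ) - (i : ℕ)) 3 6 : ℤ)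
        else 0)) = 0 := by
  simp only [dipMonomialCount_eq_L]
  decide +kernel

/-- Clamped (4.4)-sum for the tail `(3, 3, 0)` at `(d',n') = (4,3)` vanishes (kernel). [cite: DorflerIkenmeyerPanova2020, Lemma 3.13 (arXiv p. 7)] -/
private theorem t330_4_3 :
    (∑ π : Equiv.Perm (Fin (3 + 1)), ((Equiv.Perm.sign π : ℤˣ) : ℤ) *
      (if ∀ i : Fin (3 + 1), (i : ℕ) ≤ (Fin.cons (4 * 3 - 6) ![3, 3, 0] : Fin (3 + 1) → ℕ) i + (π i : ℕ)
        then (dipMonomialCount (fun i : Fin (3 + 1) => (Fin.cons (4 * 3 - 6) ![3, 3, 0] : Fin (3 + 1) → ℕ) i + (π i : ℕ) - (i : ℕ)) 4 3 : ℤ)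
        else 0)) = 0 := by
  simp only [dipMonomialCount_eq_L]
  decide +kernel

/-- Clamped (4.4)-sum for the tail `(3, 3, 0)` at `(d',n') = (4,4)` vanishes (kernel). [cite: DorflerIkenmeyerPanova2020, Lemma 3.13 (arXiv p. 7)] -/
private theorem t330_4_4 :
    (∑ π : Equiv.Perm (Fin (3 + 1)), ((Equiv.Perm.sign π : ℤˣ) : ℤ) *
      (if ∀ i : Fin (3 + 1), (i : ℕ) ≤ (Fin.cons (4 * 4 - 6) ![3, 3, 0] : Fin (3 + 1) → ℕ) i + (π i : ℕ)
        then (dipMonomialCount (fun i : Fin (3 + 1) => (Fin.cons (4 * 4 - 6) ![3, 3, 0] : Fin (3 + 1) → ℕ) i + (π i : ℕ) - (i : ℕ)) 4 4 : ℤ)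
        else 0)) = 0 := by
  simp only [dipMonomialCount_eq_L]
  decide +kernel

/-- Clamped (4.4)-sum for the tail `(3, 3, 0)` at `(d',n') = (4,5)` vanishes (kernel). [cite: DorflerIkenmeyerPanova2020, Lemma 3.13 (arXiv p. 7)] -/
private theorem t330_4_5 :
    (∑ π : Equiv.Perm (Fin (3 + 1)), ((Equiv.Perm.sign π : ℤˣ) : ℤ) *
      (if ∀ i : Fin (3 + 1), (i : ℕ) ≤ (Fin.cons (4 * 5 - 6) ![3, 3, 0] : Fin (3 + 1) → ℕ) i + (π i : ℕ)
        then (dipMonomialCount (fun i : Fin (3 + 1) => (Fin.cons (4 * 5 - 6) ![3, 3, 0] : Fin (3 + 1) → ℕ) i + (π i : ℕ) - (i : ℕ)) 4 5 : ℤ)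
        else 0)) = 0 := by
  simp only [dipMonomialCount_eq_L]
  decide +kernel

/-- Clamped (4.4)-sum for the tail `(3, 3, 0)` at `(d',n') = (4,6)` vanishes (kernel). [cite: DorflerIkenmeyerPanova2020, Lemma 3.13 (arXiv p. 7)] -/
private theorem t330_4_6 :
    (∑ π : Equiv.Perm (Fin (3 + 1)), ((Equiv.Perm.sign π : ℤˣ) : ℤ) *
      (if ∀ i : Fin (3 + 1), (i : ℕ) ≤ (Fin.cons (4 * 6 - 6) ![3, 3, 0] : Fin (3 + 1) → ℕ) i + (π i : ℕ)
        then (dipMonomialCount (fun i : Fin (3 + 1) => (Fin.cons (4 * 6 - 6) ![3, 3, 0] : Fin (3 + 1) → ℕ) i + (π i : ℕ) - (i : ℕ)) 4 6 : ℤ)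
        else 0)) = 0 := by
  simp only [dipMonomialCount_eq_L]
  decide +kernel

/-- Clamped (4.4)-sum for the tail `(3, 3, 0)` at `(d',n') = (5,2)` vanishes (kernel). [cite: DorflerIkenmeyerPanova2020, Lemma 3.13 (arXiv p. 7)] -/
private theorem t330_5_2 :
    (∑ π : Equiv.Perm (Fin (3 + 1)), ((Equiv.Perm.sign π : ℤˣ) : ℤ) *
      (if ∀ i : Fin (3 + 1), (i : ℕ) ≤ (Fin.cons (5 * 2 - 6) ![3, 3, 0] : Fin (3 + 1) → ℕ) i + (π i : ℕ)
        then (dipMonomialCount (fun i : Fin (3 + 1) => (Fin.cons (5 * 2 - 6) ![3, 3, 0] : Fin (3 + 1) → ℕ) i + (π i : ℕ) - (i : ℕ)) 5 2 : ℤ)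
        else 0)) = 0 := by
  simp only [dipMonomialCount_eq_L]
  decide +kernel

/-- Clamped (4.4)-sum for the tail `(3, 3, 0)` at `(d',n') = (5,3)` vanishes (kernel). [cite: DorflerIkenmeyerPanova2020, Lemma 3.13 (arXiv p. 7)] -/
private theorem t330_5_3 :
    (∑ π : Equiv.Perm (Fin (3 + 1)), ((Equiv.Perm.sign π : ℤˣ) : ℤ) *
      (if ∀ i : Fin (3 + 1), (i : ℕ) ≤ (Fin.cons (5 * 3 - 6) ![3, 3, 0] : Fin (3 + 1) → ℕ) i + (π i : ℕ)
        then (dipMonomialCount (fun i : Fin (3 + 1) => (Fin.cons (5 * 3 - 6) ![3, 3, 0] : Fin (3 + 1) → ℕ) i + (π i : ℕ) - (i : ℕ)) 5 3 : ℤ)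
        else 0)) = 0 := by
  simp only [dipMonomialCount_eq_L]
  decide +kernel

/-- Clamped (4.4)-sum for the tail `(3, 3, 0)` at `(d',n') = (5,4)` vanishes (kernel). [cite: DorflerIkenmeyerPanova2020, Lemma 3.13 (arXiv p. 7)] -/
private theorem t330_5_4 :
    (∑ π : Equiv.Perm (Fin (3 + 1)), ((Equiv.Perm.sign π : ℤˣ) : ℤ) *
      (if ∀ i : Fin (3 + 1), (i : ℕ) ≤ (Fin.cons (5 * 4 - 6) ![3, 3, 0] : Fin (3 + 1) → ℕ) i + (π i : ℕ)
        then (dipMonomialCount (fun i : Fin (3 + 1) => (Fin.cons (5 * 4 - 6) ![3, 3, 0] : Fin (3 + 1) → ℕ) i + (π i : ℕ) - (i : ℕ)) 5 4 : ℤ)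
        else 0)) = 0 := by
  simp only [dipMonomialCount_eq_L]
  decide +kernel

/-- Clamped (4.4)-sum for the tail `(3, 3, 0)` at `(d',n') = (5,5)` vanishes (kernel). [cite: DorflerIkenmeyerPanova2020, Lemma 3.13 (arXiv p. 7)] -/
private theorem t330_5_5 :
    (∑ π : Equiv.Perm (Fin (3 + 1)), ((Equiv.Perm.sign π : ℤˣ) : ℤ) *
      (if ∀ i : Fin (3 + 1), (i : ℕ) ≤ (Fin.cons (5 * 5 - 6) ![3, 3, 0] : Fin (3 + 1) → ℕ) i + (π i : ℕ)
        then (dipMonomialCount (fun i : Fin (3 + 1) => (Fin.cons (5 * 5 - 6) ![3, 3, 0] : Fin (3 + 1) → ℕ) i + (π i : ℕ) - (i : ℕ)) 5 5 : ℤ)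
        else 0)) = 0 := by
  simp only [dipMonomialCount_eq_L]
  decide +kernel

/-- Clamped (4.4)-sum for the tail `(3, 3, 0)` at `(d',n') = (5,6)` vanishes (kernel). [cite: DorflerIkenmeyerPanova2020, Lemma 3.13 (arXiv p. 7)] -/
private theorem t330_5_6 :
    (∑ π : Equiv.Perm (Fin (3 + 1)), ((Equiv.Perm.sign π : ℤˣ) : ℤ) *
      (if ∀ i : Fin (3 + 1), (i : ℕ) ≤ (Fin.cons (5 * 6 - 6) ![3, 3, 0] : Fin (3 + 1) → ℕ) i + (π i : ℕ)
        then (dipMonomialCount (fun i : Fin (3 + 1) => (Fin.cons (5 * 6 - 6) ![3, 3, 0] : Fin (3 + 1) → ℕ) i + (π i : ℕ) - (i : ℕ)) 5 6 : ℤ)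
        else 0)) = 0 := by
  simp only [dipMonomialCount_eq_L]
  decide +kernel

/-- Clamped (4.4)-sum for the tail `(3, 3, 0)` at `(d',n') = (6,1)` vanishes (kernel). [cite: DorflerIkenmeyerPanova2020, Lemma 3.13 (arXiv p. 7)] -/
private theorem t330_6_1 :
    (∑ π : Equiv.Perm (Fin (3 + 1)), ((Equiv.Perm.sign π : ℤˣ) : ℤ) *
      (if ∀ i : Fin (3 + 1), (i : ℕ) ≤ (Fin.cons (6 * 1 - 6) ![3, 3, 0] : Fin (3 + 1) → ℕ) i + (π i : ℕ)
        then (dipMonomialCount (fun i : Fin (3 + 1) => (Fin.cons (6 * 1 - 6) ![3, 3, 0] : Fin (3 + 1) → ℕ) i + (π i : ℕ) - (i : ℕ)) 6 1 : ℤ)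
        else 0)) = 0 := by
  simp only [dipMonomialCount_eq_L]
  decide +kernel

/-- Clamped (4.4)-sum for the tail `(3, 3, 0)` at `(d',n') = (6,2)` vanishes (kernel). [cite: DorflerIkenmeyerPanova2020, Lemma 3.13 (arXiv p. 7)] -/
private theorem t330_6_2 :
    (∑ π : Equiv.Perm (Fin (3 + 1)), ((Equiv.Perm.sign π : ℤˣ) : ℤ) *
      (if ∀ i : Fin (3 + 1), (i : ℕ) ≤ (Fin.cons (6 * 2 - 6) ![3, 3, 0] : Fin (3 + 1) → ℕ) i + (π i : ℕ)
        then (dipMonomialCount (fun i : Fin (3 + 1) => (Fin.cons (6 * 2 - 6) ![3, 3, 0] : Fin (3 + 1) → ℕ) i + (π i : ℕ) - (i : ℕ)) 6 2 : ℤ)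
        else 0)) = 0 := by
  simp only [dipMonomialCount_eq_L]
  decide +kernel

/-- Clamped (4.4)-sum for the tail `(3, 3, 0)` at `(d',n') = (6,3)` vanishes (kernel). [cite: DorflerIkenmeyerPanova2020, Lemma 3.13 (arXiv p. 7)] -/
private theorem t330_6_3 :
    (∑ π : Equiv.Perm (Fin (3 + 1)), ((Equiv.Perm.sign π : ℤˣ) : ℤ) *
      (if ∀ i : Fin (3 + 1), (i : ℕ) ≤ (Fin.cons (6 * 3 - 6) ![3, 3, 0] : Fin (3 + 1) → ℕ) i + (π i : ℕ)
        then (dipMonomialCount (fun i : Fin (3 + 1) => (Fin.cons (6 * 3 - 6) ![3, 3, 0] : Fin (3 + 1) → ℕ) i + (π i : ℕ) - (i : ℕ)) 6 3 : ℤ)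
        else 0)) = 0 := by
  simp only [dipMonomialCount_eq_L]
  decide +kernel

/-- Clamped (4.4)-sum for the tail `(3, 3, 0)` at `(d',n') = (6,4)` vanishes (kernel). [cite: DorflerIkenmeyerPanova2020, Lemma 3.13 (arXiv p. 7)] -/
private theorem t330_6_4 :
    (∑ π : Equiv.Perm (Fin (3 + 1)), ((Equiv.Perm.sign π : ℤˣ) : ℤ) *
      (if ∀ i : Fin (3 + 1), (i : ℕ) ≤ (Fin.cons (6 * 4 - 6) ![3, 3, 0] : Fin (3 + 1) → ℕ) i + (π i : ℕ)
        then (dipMonomialCount (fun i : Fin (3 + 1) => (Fin.cons (6 * 4 - 6) ![3, 3, 0] : Fin (3 + 1) → ℕ) i + (π i : ℕ) - (i : ℕ)) 6 4 : ℤ)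
        else 0)) = 0 := by
  simp only [dipMonomialCount_eq_L]
  decide +kernel

/-- Clamped (4.4)-sum for the tail `(3, 3, 0)` at `(d',n') = (6,5)` vanishes (kernel). [cite: DorflerIkenmeyerPanova2020, Lemma 3.13 (arXiv p. 7)] -/
private theorem t330_6_5 :
    (∑ π : Equiv.Perm (Fin (3 + 1)), ((Equiv.Perm.sign π : ℤˣ) : ℤ) *
      (if ∀ i : Fin (3 + 1), (i : ℕ) ≤ (Fin.cons (6 * 5 - 6) ![3, 3, 0] : Fin (3 + 1) → ℕ) i + (π i : ℕ)
        then (dipMonomialCount (fun i : Fin (3 + 1) => (Fin.cons (6 * 5 - 6) ![3, 3, 0] : Fin (3 + 1) → ℕ) i + (π i : ℕ) - (i : ℕ)) 6 5 : ℤ)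
        else 0)) = 0 := by
  simp only [dipMonomialCount_eq_L]
  decide +kernel

/-- Clamped (4.4)-sum for the tail `(3, 3, 0)` at `(d',n') = (6,6)` vanishes (kernel). [cite: DorflerIkenmeyerPanova2020, Lemma 3.13 (arXiv p. 7)] -/
private theorem t330_6_6 :
    (∑ π : Equiv.Perm (Fin (3 + 1)), ((Equiv.Perm.sign π : ℤˣ) : ℤ) *
      (if ∀ i : Fin (3 + 1), (i : ℕ) ≤ (Fin.cons (6 * 6 - 6) ![3, 3, 0] : Fin (3 + 1) → ℕ) i + (π i : ℕ)
        then (dipMonomialCount (fun i : Fin (3 + 1) => (Fin.cons (6 * 6 - 6) ![3, 3, 0] : Fin (3 + 1) → ℕ) i + (π i : ℕ) - (i : ℕ)) 6 6 : ℤ)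
        else 0)) = 0 := by
  simp only [dipMonomialCount_eq_L]
  decide +kernel

set_option maxHeartbeats 1000000 in
/-- **Lemma 3.13, the tail `(3, 3, 0)`**: for a 4-partition `μ` with `μ̄ = (3, 3, 0)`, `a_μ(d[n]) = 0` for
every `n` (degree pinning; (4.4); clamping at `(min d 6, min n 6)`; kernel).
[cite: DorflerIkenmeyerPanova2020, Lemma 3.13 (arXiv p. 7; TeX multobs.tex L480 {lem:vanishingpleth74})] -/
theorem plethysmCoeff_rowDual_tail330_eq_zero (n : ℕ) (μ : Fin 4 → ℕ) (hμ : Antitone μ)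
    (h1 : μ 1 = 3) (h2 : μ 2 = 3) (h3 : μ 3 = 0) : plethysmCoeff ℂ (Fin 4) n (rowDual μ) = 0 := by
  have h10 : 3 ≤ μ 0 := by have := hμ (show (0 : Fin 4) ≤ 1 by decide); omega
  have hsumμ : ∑ i, μ i = μ 0 + 6 := by
    simp [Fin.sum_univ_four, h1, h2, h3]
  by_cases hdvd : n ∣ ∑ i, μ i
  swap
  · exact plethysmCoeff_rowDual_eq_zero_of_not_dvd μ n hdvd
  rcases Nat.eq_zero_or_pos n with rfl | hn
  · rw [Nat.zero_dvd] at hdvd; omega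
  obtain ⟨d, hd⟩ := hdvd
  have hL : μ 0 + 6 = d * n := by rw [← hsumμ, hd, Nat.mul_comm]
  have hd1 : 1 ≤ d := Nat.pos_of_ne_zero (by rintro rfl; simp at hL)
  have hτ : ∑ j, (![3, 3, 0] : Fin 3 → ℕ) j = 6 := by simp [Fin.sum_univ_three]
  have hμeq : μ = (Fin.cons (d * n - ∑ j, (![3, 3, 0] : Fin 3 → ℕ) j) ![3, 3, 0] : Fin (3 + 1) → ℕ) := by
    funext i
    fin_cases i
    · simp [hτ]; omega
    · simp [h1]
    · simp [h2]
    · simp [h3]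
  have h44 := DIP20_eq_4_4_holds (3 + 1) n d _ hn (hμeq ▸ hμ) (by rw [← hμeq, hsumμ]; omega)
  rw [dip44_sum_cons_clamp (![3, 3, 0] : Fin 3 → ℕ) (T := 6) hn hd1 (by norm_num) (by rw [hτ])
    (by rw [hτ]; omega)] at h44
  simp only [hτ] at h44
  obtain ⟨d', hd'⟩ : ∃ d', min d 6 = d' := ⟨_, rfl⟩
  obtain ⟨n', hn'⟩ : ∃ n', min n 6 = n' := ⟨_, rfl⟩
  rw [hd', hn'] at h44
  have hbig : 9 ≤ d' * n' ∨ d' = 6 ∨ n' = 6 := by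
    rcases le_or_gt 6 d with h6 | h6
    · right; left; rw [← hd']; exact Nat.min_eq_right h6
    rcases le_or_gt 6 n with h6' | h6'
    · right; right; rw [← hn']; exact Nat.min_eq_right h6'
    left
    have e1 : d' = d := by rw [← hd']; exact Nat.min_eq_left h6.le
    have e2 : n' = n := by rw [← hn']; exact Nat.min_eq_left h6'.le
    rw [e1, e2]; omega
  have hd'1 : 1 ≤ d' := by rw [← hd']; exact le_min hd1 (by norm_num)
  have hd'6 : d' ≤ 6 := by rw [← hd']; exact Nat.min_le_right _ _
  have hn'1 : 1 ≤ n' := by rw [← hn']; exact le_min hn (by norm_num)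
  have hn'6 : n' ≤ 6 := by rw [← hn']; exact Nat.min_le_right _ _
  have hμeq' : μ = (Fin.cons (d * n - 6) ![3, 3, 0] : Fin (3 + 1) → ℕ) := by rw [hμeq, hτ]
  rw [← hμeq'] at h44
  have key : (plethysmCoeff ℂ (Fin (3 + 1)) n (rowDual μ) : ℤ) = 0 := by
    rw [h44]
    clear h44 hd' hn' hμeq hμeq'
    interval_cases d' <;> interval_cases n'
    any_goals (exfalso; omega)
    · exact t330_1_6
    · exact t330_2_5
    · exact t330_2_6
    · exact t330_3_3
    · exact t330_3_4
    · exact t330_3_5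
    · exact t330_3_6
    · exact t330_4_3
    · exact t330_4_4
    · exact t330_4_5
    · exact t330_4_6
    · exact t330_5_2
    · exact t330_5_3
    · exact t330_5_4
    · exact t330_5_5
    · exact t330_5_6
    · exact t330_6_1
    · exact t330_6_2
    · exact t330_6_3
    · exact t330_6_4
    · exact t330_6_5
    · exact t330_6_6
  exact_mod_cast key

end Literature.Computability.AlgebraicComplexity
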